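import Summits.PneNP.PneNP.Theorems.ChebyshevTracialDesignSpectralNonTightnessEstimates
import HarnessLib

/-!
# Cell pnp-psdrank, route `ChebyshevTracialDesign`: the CONSTANTS of the `r = 1` rung — the three terms of the spread-approximation
# bound at the exp scale

Harmonic backbone of the crux `TracialDecayExp20` (stmt-PneNP-19878), brick 32a (prover g8; step S6, MEMO-10 §3). Pure real arithmetic for the
assembly `…RungAssembly`: with `τ = e`, `q + 1 ∈ [aD + 5, aD + 6]`, `a = c₀/80`, `c₀ ≤ 1`, `c₀D ≥ 16`, `β = exp(−c₀(D−1))`, and the crossing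
attenuation `P` with `P·D^{3κ} ≤ 2^κ`, `n ≤ 16D⁴`, `κ ≥ 18q + 18`:
* `remainder_term_le` — `20·e^{−(q+1)} ≤ e^{−aD}/3`;
* `junk_term_le` — `20·β·e^{q+1} ≤ e^{−aD}/3`;
* `crossing_term_core` / `crossing_term_le` — `3600·e^{4(q+1)}·(4n)^{2q}·P ≤ 1`, hence `20·e^{q+1}·n^q·4^q·√P ≤ e^{−aD}/3`;
* `pred_pow_four_add_le` — `(D−1)⁴ + D ≤ D⁴` (so `dq(n − 2q) ≥ dq n − 1` when `2q ≤ dq n`).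
[cite: Rothvoss2017, §2 and Lemma 7 (PDF pp. 6–8)] [cite: KupavskiiZakharov2022, Lemma 11]
Stature: support/instrument (bookkeeping). WHAT THIS IS NOT: nothing on psd rank, no P-vs-NP content. Supports stmt-PneNP-19878.
-/

set_option linter.dupNamespace false -- `Summit.PneNP.PneNP.…`: summit = sub-problem (D-0017)

noncomputable section

namespace Summit.PneNP.PneNP.Theorems.ChebyshevTracialDesignRungConstants

open Finset

/-! ### §1 The three terms at the exp scale -/

/-- `e⁴ ≤ 64`. [folklore] -/
theorem exp_one_pow_four_le : Real.exp 1 ^ 4 ≤ 64 := by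
  have h := Real.exp_one_lt_d9
  have h0 := (Real.exp_pos 1).le
  nlinarith [pow_le_pow_left₀ h0 h.le 4]

/-- `60 ≤ e⁵` and `60 ≤ e⁸`. [folklore] -/
theorem sixty_le_exp_one_pow_five : (60 : ℝ) ≤ Real.exp 1 ^ 5 := by
  have h := Real.exp_one_gt_d9
  calc (60 : ℝ) ≤ 2.7182818283 ^ 5 := by norm_num
    _ ≤ Real.exp 1 ^ 5 := pow_le_pow_left₀ (by norm_num) h.le 5

/-- **Remainder term**: `20·e^{−(q+1)} ≤ e^{−aD}/3` once `q + 1 ≥ aD + 5`. [cite: KupavskiiZakharov2022, Lemma 11 (iii)] -/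
theorem remainder_term_le {a D : ℝ} {q : ℕ} (hq : a * D + 5 ≤ (q : ℝ) + 1) :
    20 * (Real.exp 1 ^ (q + 1))⁻¹ ≤ Real.exp (-(a * D)) / 3 := by
  rw [Real.exp_one_pow, ← Real.exp_neg]
  have h1 : Real.exp (-((q + 1 : ℕ) : ℝ)) ≤ Real.exp (-(a * D)) * Real.exp (-5) := by
    rw [← Real.exp_add]; exact Real.exp_le_exp.2 (by push_cast; linarith)
  have he5 : (60 : ℝ) ≤ Real.exp 5 := by
    have := sixty_le_exp_one_pow_five; rwa [Real.exp_one_pow, Nat.cast_ofNat] at this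
  have h5 : Real.exp (-5) * 60 ≤ 1 := by
    rw [Real.exp_neg, inv_mul_le_iff₀ (Real.exp_pos 5), mul_one]; exact he5
  have hpos : 0 < Real.exp (-(a * D)) := Real.exp_pos _
  have h2 := mul_le_mul_of_nonneg_left h5 hpos.le
  linarith

/-- **Junk term**: with `β = exp(−c₀(D−1))`, `c₀ ≤ 1`, `16 ≤ c₀D`, `a = c₀/80` and `q + 1 ≤ aD + 6`: `20·β·e^{q+1} ≤ e^{−aD}/3`.
[cite: Rothvoss2017, §2 (PDF p. 6)] -/
theorem junk_term_le {c₀ D : ℝ} {q : ℕ} (hc₀1 : c₀ ≤ 1) (hcD : 16 ≤ c₀ * D) (hq : (q : ℝ) + 1 ≤ c₀ / 80 * D + 6) :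
    20 * (Real.exp (-(c₀ * (D - 1))) * Real.exp 1 ^ (q + 1)) ≤ Real.exp (-(c₀ / 80 * D)) / 3 := by
  rw [Real.exp_one_pow, ← Real.exp_add]
  -- `60 · exp(−c₀(D−1) + (q+1)) ≤ exp(−aD)` ⟸ `60 ≤ exp(8) ≤ exp(c₀ D − c₀ − (q+1) − aD)`
  have hexp : -(c₀ * (D - 1)) + ((q + 1 : ℕ) : ℝ) ≤ -(c₀ / 80 * D) + -8 := by push_cast; nlinarith
  have h1 : Real.exp (-(c₀ * (D - 1)) + ((q + 1 : ℕ) : ℝ)) ≤ Real.exp (-(c₀ / 80 * D)) * Real.exp (-8) := by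
    rw [← Real.exp_add]; exact Real.exp_le_exp.2 hexp
  have he8 : (60 : ℝ) ≤ Real.exp 8 := by
    have h := sixty_le_exp_one_pow_five
    have h' : Real.exp 1 ^ 5 ≤ Real.exp 1 ^ 8 :=
      pow_le_pow_right₀ (by have := Real.add_one_le_exp (1 : ℝ); linarith) (by norm_num)
    have h'' := h.trans h'
    rwa [Real.exp_one_pow, Nat.cast_ofNat] at h''
  have h8 : Real.exp (-8) * 60 ≤ 1 := by
    rw [Real.exp_neg, inv_mul_le_iff₀ (Real.exp_pos 8), mul_one]; exact he8
  have hpos : 0 < Real.exp (-(c₀ / 80 * D)) := Real.exp_pos _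
  have h2 := mul_le_mul_of_nonneg_left h8 hpos.le
  linarith

/-- **Crossing term, core inequality**: if `P·D^{3κ} ≤ 2^κ`, `n ≤ 16D⁴`, `18q + 18 ≤ κ` and `D ≥ 2`, then
`3600·e^{4(q+1)}·(4n)^{2q}·P ≤ 1`. [cite: Rothvoss2017, Lemma 7 (PDF pp. 7–8)] -/
theorem crossing_term_core {P : ℝ} {n q κ D : ℕ} (hP0 : 0 ≤ P) (hP : P * (D : ℝ) ^ (3 * κ) ≤ (2 : ℝ) ^ κ) (hD : 2 ≤ D)
    (hn : (n : ℝ) ≤ 16 * (D : ℝ) ^ 4) (hκ : 18 * q + 18 ≤ κ) :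
    3600 * Real.exp 1 ^ (4 * (q + 1)) * ((4 : ℝ) * n) ^ (2 * q) * P ≤ 1 := by
  have hDpos : (0 : ℝ) < D := by exact_mod_cast (show 0 < D by omega)
  have hD1 : (1 : ℝ) ≤ D := by exact_mod_cast (show 1 ≤ D by omega)
  have hD3 : (0 : ℝ) < (D : ℝ) ^ (3 * κ) := by positivity
  have h1 : Real.exp 1 ^ (4 * (q + 1)) ≤ (2 : ℝ) ^ (6 * (q + 1)) := by
    rw [pow_mul, pow_mul]
    exact pow_le_pow_left₀ (by positivity) (exp_one_pow_four_le.trans (by norm_num)) _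
  have h2 : ((4 : ℝ) * n) ^ (2 * q) ≤ (2 : ℝ) ^ (12 * q) * (D : ℝ) ^ (8 * q) := by
    calc ((4 : ℝ) * n) ^ (2 * q) ≤ ((2 : ℝ) ^ 6 * (D : ℝ) ^ 4) ^ (2 * q) :=
          pow_le_pow_left₀ (by positivity) (by nlinarith) _
      _ = (2 : ℝ) ^ (12 * q) * (D : ℝ) ^ (8 * q) := by rw [mul_pow, ← pow_mul, ← pow_mul]; ring_nf
  rw [← mul_le_mul_iff_of_pos_right hD3, one_mul]
  have h3 : (3600 : ℝ) ≤ 2 ^ 12 := by norm_num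
  have h4 : (2 : ℝ) ^ (κ + 18 * q + 18) ≤ 2 ^ (2 * κ) := pow_le_pow_right₀ (by norm_num) (by omega)
  have h5 : (D : ℝ) ^ (8 * q) ≤ (D : ℝ) ^ κ := pow_le_pow_right₀ hD1 (by omega)
  have h6 : (2 : ℝ) ^ (2 * κ) ≤ (D : ℝ) ^ (2 * κ) := pow_le_pow_left₀ (by norm_num) (by exact_mod_cast hD) _
  calc 3600 * Real.exp 1 ^ (4 * (q + 1)) * ((4 : ℝ) * n) ^ (2 * q) * P * (D : ℝ) ^ (3 * κ)
      = 3600 * Real.exp 1 ^ (4 * (q + 1)) * ((4 : ℝ) * n) ^ (2 * q) * (P * (D : ℝ) ^ (3 * κ)) := by ring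
    _ ≤ 2 ^ 12 * (2 : ℝ) ^ (6 * (q + 1)) * ((2 : ℝ) ^ (12 * q) * (D : ℝ) ^ (8 * q)) * (2 : ℝ) ^ κ := by
        gcongr
    _ = (2 : ℝ) ^ (κ + 18 * q + 18) * (D : ℝ) ^ (8 * q) := by ring
    _ ≤ (2 : ℝ) ^ (2 * κ) * (D : ℝ) ^ κ := mul_le_mul h4 h5 (by positivity) (by positivity)
    _ ≤ (D : ℝ) ^ (2 * κ) * (D : ℝ) ^ κ := mul_le_mul_of_nonneg_right h6 (by positivity)
    _ = (D : ℝ) ^ (3 * κ) := by ring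

/-- **Crossing term**: under the hypotheses of `crossing_term_core` and `aD ≤ q + 1`,
`20·e^{q+1}·n^q·(4^q·√P) ≤ e^{−aD}/3`. [cite: Rothvoss2017, Lemma 7 (PDF pp. 7–8)] -/
theorem crossing_term_le {P a : ℝ} {n q κ D : ℕ} (hP0 : 0 ≤ P) (hP : P * (D : ℝ) ^ (3 * κ) ≤ (2 : ℝ) ^ κ) (hD : 2 ≤ D)
    (hn : (n : ℝ) ≤ 16 * (D : ℝ) ^ 4) (hκ : 18 * q + 18 ≤ κ) (haq : a * D ≤ (q : ℝ) + 1) :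
    20 * (Real.exp 1 ^ (q + 1) * (n : ℝ) ^ q * ((4 : ℝ) ^ q * Real.sqrt P)) ≤ Real.exp (-(a * D)) / 3 := by
  have hcore := crossing_term_core hP0 hP hD hn hκ
  -- `X := 60 e^{q+1} (4n)^q e^{aD}` has `X² P ≤ 1`
  set X : ℝ := 60 * Real.exp 1 ^ (q + 1) * ((4 : ℝ) * n) ^ q * Real.exp (a * D) with hX
  have hX0 : 0 ≤ X := by rw [hX]; positivity
  have hea : Real.exp (a * D) ≤ Real.exp 1 ^ (q + 1) := by
    rw [Real.exp_one_pow]; exact Real.exp_le_exp.2 (by push_cast; linarith)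
  have hX2 : X ^ 2 * P ≤ 1 := by
    have h1 : X ^ 2 ≤ 3600 * Real.exp 1 ^ (4 * (q + 1)) * ((4 : ℝ) * n) ^ (2 * q) := by
      rw [hX]
      calc (60 * Real.exp 1 ^ (q + 1) * ((4 : ℝ) * n) ^ q * Real.exp (a * D)) ^ 2
          ≤ (60 * Real.exp 1 ^ (q + 1) * ((4 : ℝ) * n) ^ q * Real.exp 1 ^ (q + 1)) ^ 2 := by gcongr
        _ = 3600 * Real.exp 1 ^ (4 * (q + 1)) * ((4 : ℝ) * n) ^ (2 * q) := by ring
    calc X ^ 2 * P ≤ 3600 * Real.exp 1 ^ (4 * (q + 1)) * ((4 : ℝ) * n) ^ (2 * q) * P := mul_le_mul_of_nonneg_right h1 hP0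
      _ ≤ 1 := hcore
  have hXP : X * Real.sqrt P ≤ 1 := by
    have : X * Real.sqrt P = Real.sqrt (X ^ 2 * P) := by
      rw [Real.sqrt_mul (sq_nonneg _), Real.sqrt_sq hX0]
    rw [this]
    exact (Real.sqrt_le_sqrt hX2).trans_eq Real.sqrt_one
  -- unfold `X`
  have hkey : 60 * (Real.exp 1 ^ (q + 1) * (n : ℝ) ^ q * ((4 : ℝ) ^ q * Real.sqrt P)) * Real.exp (a * D) ≤ 1 := by
    calc 60 * (Real.exp 1 ^ (q + 1) * (n : ℝ) ^ q * ((4 : ℝ) ^ q * Real.sqrt P)) * Real.exp (a * D) = X * Real.sqrt P := by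
          rw [hX, mul_pow]; ring
      _ ≤ 1 := hXP
  have hE : Real.exp (a * D) * Real.exp (-(a * D)) = 1 := by rw [← Real.exp_add, add_neg_cancel, Real.exp_zero]
  calc 20 * (Real.exp 1 ^ (q + 1) * (n : ℝ) ^ q * ((4 : ℝ) ^ q * Real.sqrt P))
      = 20 * (Real.exp 1 ^ (q + 1) * (n : ℝ) ^ q * ((4 : ℝ) ^ q * Real.sqrt P)) * (Real.exp (a * D) * Real.exp (-(a * D))) := by
        rw [hE, mul_one]
    _ = (60 * (Real.exp 1 ^ (q + 1) * (n : ℝ) ^ q * ((4 : ℝ) ^ q * Real.sqrt P)) * Real.exp (a * D)) * (Real.exp (-(a * D)) / 3) := by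
        ring
    _ ≤ 1 * (Real.exp (-(a * D)) / 3) := mul_le_mul_of_nonneg_right hkey (by positivity)
    _ = Real.exp (-(a * D)) / 3 := one_mul _

/-! ### §2 A size-parameter inequality -/

/-- `(D−1)⁴ + D ≤ D⁴` for `D ≥ 1`. [folklore] -/
theorem pred_pow_four_add_le {D : ℕ} (hD : 1 ≤ D) : (D - 1) ^ 4 + D ≤ D ^ 4 := by
  obtain ⟨E, rfl⟩ : ∃ E, D = E + 1 := ⟨D - 1, by omega⟩
  rw [Nat.add_sub_cancel]
  have h1 : (E + 1) ^ 4 = E ^ 4 + (4 * E ^ 3 + 6 * E ^ 2 + 4 * E + 1) := by ring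
  rw [h1]
  apply Nat.add_le_add_left
  nlinarith [Nat.zero_le (E ^ 3), Nat.zero_le (E ^ 2)]

end Summit.PneNP.PneNP.Theorems.ChebyshevTracialDesignRungConstants
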